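import Literature.MathematicalPhysics.QuantumFieldTheory.Balaban1983to89.B8Prop6Reg335Cube
import Literature.MathematicalPhysics.QuantumFieldTheory.Balaban1983to89.B8Prop6PrintedZdCubPGamma
import Literature.MathematicalPhysics.QuantumFieldTheory.Balaban1983to89.B9SupplySockB9P3ZdAt
import Literature.MathematicalPhysics.QuantumFieldTheory.Balaban1983to89.B9SupplySockB9P3ZdFrame
import Literature.MathematicalPhysics.QuantumFieldTheory.Balaban1983to89.B8Thm2TorusMember

/-!
# `Balaban1983to89.B8Prop6Reg335ZdAllTorus` — [Balaban1985RegularSpaces] PROPOSITION 6's PRINTED APPLICATION AT THE FRAME OF RECORD: «hence for α₀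
# sufficiently small we have proved the regularity condition (3.35). This implies that we can drop out this condition from the assumption (1.33)»
# (p. 99) — dag-n06-b's junction binder `B9SupplySockB9P3ZdAt.Prop6At` AT dag-n06-e's `ℤᵈ` frame `B9SupplySockB9P3ZdFrame.bgZd` (genuine (3.35) class
# `Reg335Zd` on [4]'s p. 396 cube class `cubeClass396Zd`) is a THEOREM at every all-torus member (`Ω_j = ℤᵈ`), every block parameter `M ≥ 1` and
# every truncation `m`, from `B8.Prop6Printed` on print's cube class; UNCONDITIONAL for `d ≥ 2`, odd `L ≥ 5` (`B8Prop6PrintedZdCubPGamma.prop6Printed_zdCubP_γ_holds`)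

statement-level skeleton of published theorems with citation tags; proofs where landed; nothing here is a claim about the
Yang–Mills mass gap

PDF held: `paper:balaban1985-cmp99-regular-spaces-gauge-fixing` p. 98–99 (p0024–p0025: «Now let us take a cube □ ⊂ Ω₀ for which we want to prove the condition
(3.35). A size of this cube depends on an index j indicating a scale we are interested in … To prove condition (3.35) it is enough to take one such cube. Having
in view future applications we take a size of □ equal to MLʲη, where M is a multiple of R₁M₁ … we have to admit the value k = 0. In this case the reasoning is
much simpler and will be covered by our analysis of a general case, so we can assume that k ≥ 1»; Proposition 6; «hence … we have proved the regularity
condition (3.35). This implies that we can drop out this condition from the assumption (1.33)»), p. 82 ((1.33) «U₀ satisfies the regularity condition (3.35)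
in [4] … eventually we will drop it out of the assumptions»); [4] = [Balaban1985BackgroundPropagators] p. 396 (the cube class: «□ is a union of several big
blocks of the lattice T_{Lʲη}, which implies that its size in the lattice T_η is O(1)MLʲη. Here O(1) will mean a number ≤ 10»; (3.35)).  Read on the held text
layer by this seat (2026-08-28).

WHY THIS FILE (cell `pub-ymgap`, YM-PLAN Track A node N05, FAN-OUT §N05 row s3b; seat `pub-ymgap-dag-n05-e` (g14); count-neutral).  See the companion
`B8Prop6Reg335Cube` (per-cube bridge).  The J-N06→N05 junction's member-local binder `Prop6At bg L mem ιCfg c35 c₆ K₆ M i m` («(3.35) for U₀ by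
Proposition 6» — [B8] Prop. 6's ONLY printed purpose) is displayed as a HYPOTHESIS over the pinned all-torus sub-index
`{i : ZdIdx d L // (∀ j, i.Ω j = univ) ∧ …}` in `BalabanUVNodesN16LeafLettersAllTorusOfThm33` (`hP6`), the N27 ∕ K3-spine producers, and (at law members) in
N05's univ knits; inhabited so far only at a witness frame with «`Reg335 := ⊤`» (`B9SupplySockB9P3ZdUnivWitness` :648).  At the frame of record `bgZd` (where
`DictGlob` is a theorem and `B9.Thm33Printed` is N06's sentence by name, `B9SupplySockB9P3ZdInstance`) THIS FILE makes it a theorem at the all-torus members.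

WHAT IS PROVED (kernel-checked; 7 theorems; 0 sorry; 0 `def` — the ledger records an eighth declaration under this module, `B9SupplySockB9P3ZdFrame.bigSideZd.eq_1`:
the equation lemma Lean generates on demand for the FRAME's `def bigSideZd` when §1 ∕ §2 unfold it (`simp [bigSideZd]`, `push_cast [bigSideZd]`,
`rw [bigSideZd, …]`); it is not a declaration of this file's namespace and defines nothing; `𝔸 : Type` a nontrivial C⋆-algebra — the frame's universe).
* §1 `l1_le_of_mem_boxZd` (an index-`j` class cube of side `s` fine sites has `ℓ¹`-radius `≤ d·s` about its corner) and ★ `exists_printCube_over_classCube` —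
  **THE INSCRIPTION** (print p. 98: «we take a size of □ equal to MLʲη, where M is a multiple of R₁M₁ … Without a loss of generality we can assume also that
  j = k»): at an all-torus member, every cube `□` of [4]'s p. 396 class of index `1 ≤ j ≤ m` (`IsCube396Zd M L j □`: side `n·⌈M⌉₊·Lʲ`, `n ≤ 10`, corner on the
  big-block grid) lies in `box L c.a c.M c.k` of a PRINT cube `c : Node00.CubeB8 d L m (Ω ≡ ℤᵈ)` at big-block size `ρ₀` (`c.IsPrint ρ₀`) with `c.k = j`,
  collar `ρ = ρ₀L`, side `c.M = ρ₀L(n⌈M⌉₊ + 11d + 1) ≤ ρ₀L(10⌈M⌉₊ + 11d + 1)` (corner = the class cube's corner rounded down to the `ρ₀`-grid; print's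
  «11d < M», «L ≤ ρ ≤ M» hold; the two containments of `CubeB8` are trivial at `Ω ≡ ℤᵈ`).
* §2 ★★ `prop6At_bgZd_allTorus_of_prop6Printed` — **(3.35) FOR `U₀ ∈ 𝔄_m` BY PROPOSITION 6, AT THE FRAME OF RECORD**: for `d ≥ 2`, `L ≥ 2`, `ρ₀ ≥ 1`,
  `B₁ ≥ 0`, `c₁ > 0` and `B8.Prop6Printed d L B₁ c₁ (zdCubP 𝔸 L ρ₀ ∘ f)` for every index map `f` (the shape `prop6Printed_zdCubP_γ_holds` proves), EVERY
  `i : ZdIdx d L` with `∀ j, i.Ω j = univ`, every `M ≥ 1` and every `m`: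
  `Prop6At (bgZd 𝔸 L) L memZd (ιCfgZd 𝔸 L) c35 c₆ 1 M i m` with the EXPLICIT constants `c35 := 7dL³B₁ρ₀(11d + 21) + 84d + 1`,
  `c₆ := min (1∕(42d)) (c₁ ∕ (7dL³ρ₀(11d + 21)))`, `K₆ := 1`.  Proof: unfold (`reg335_bgZd_iff`, `reg335Zd_iff`'s `Reg335` = cube-wise `Reg335Cube`); a class
  cube of index `0` is served by `B8Prop6Reg335Cube.reg335Cube_index_zero` (level-0 clause of `InAk`, `ℓ¹`-radius `≤ 20dM`); a class cube of index `j ≥ 1` is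
  inscribed (§1) into a print cube of the auxiliary all-torus datum `B8Thm2TorusMember.torusIdx ⟨i.η, m⟩` (same `η`, truncation `m` as its top level, `Ω ≡ ℤᵈ`
  — so `InAk L m i.η α₀ i.Ω` IS its `InA`), Proposition 6 gives `GaugedBoundB8 … c (7dL²B₁·c.M·α₀)` there (threshold `7dL²·c.M·α₀ ≤ c₁` from `Mα₀ ≤ c₆` and
  `c.M ≤ ρ₀L(11d + 21)M`), and `B8Prop6Reg335Cube.reg335Cube_of_gaugedBoundB8` turns it into the (3.35)-clause on `□` at scale `Lʲη` with constant
  `c35·M·α₀ > 7dL²B₁·c.M·α₀`.  `prop6At_bgZd_mono` (the binder is monotone in `c35` — [4]'s «O(1)» is any admissible number) and the `∃`-packaging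
  `exists_prop6At_bgZd_allTorus_of_prop6Printed`.
* §3 ★★★ `prop6At_bgZd_allTorus_holds` (`d ≥ 2`, `L ≥ 5` odd) — **UNCONDITIONAL**: `∃ c35 c₆ K₆, 0 < c35 ∧ 0 < c₆ ∧ 0 < K₆ ∧ ∀ M ≥ 1, ∀ i` all-torus, `∀ m,
  Prop6At (bgZd 𝔸 L) L memZd (ιCfgZd 𝔸 L) c35 c₆ K₆ M i m` — §2 ∘ `prop6Printed_zdCubP_γ_holds` (ITS constants `ρ₀, B₀, c₁`, `B₁ = 5dLB₀`); and
  `prop6At_binder_allTorusPinned_holds` — EXACTLY the consumers' binder shape `∀ (M : ℝ) (i : {i // (∀ j, i.Ω j = univ) ∧ P i}) (m : ℕ), M₃ ≤ M → Prop6At …`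
  (any further pin `P`, e.g. N16's `Λs ∕ Λb ∕ η` clauses) with `M₃ = 1`.
HONEST SCOPE.  (a) ALL-TORUS MEMBERS ONLY (`Ω_j = ℤᵈ` for all `j` — the N16 ∕ N27 ∕ K3 pinned sub-index).  At a general law member (`i.Ω 0 = univ` only, N05's
`hP6at`) print's collars `□ ⊂ □̃ ⊂ □_k ⊂ … ⊂ □₀` need ROOM inside `Ω_{j−1}` around a class cube near `∂Ω_j` ([B6] (2.2) ∕ (1.4) separation, NOT a field of
`ZdIdx` — dag-n06-e's HONEST SCOPE (b)); that case is a LOCATED sequel (same two tools + a separation hypothesis), not this file — since DONE in the companion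
`B8Prop6Reg335ZdLawMember` (dag-n05-e g14): every law member with `i.Ω 0 = univ` and `B8ConstraintBonds.DomainSeq L i.Ω` (print's (1.3)–(1.4)), `M ≥ 11d + 1`,
by lowering the print cube's index `s` scales («change a scale», p. 98) so that ONE `DomainSeq.sep` hosts print's collars.  (b) CONSTANTS EXPLICIT and
monotone: `Prop6At` only weakens as `c35` grows (`prop6At_bgZd_mono`); the junction reads ONE `c35` in both `B9.Thm33Printed c35 …` (N06's sentence) and
`Prop6At` — N06's supplier must serve `Thm33Printed` at a `c35 ≥` the one here (print p. 399: «the constants depend on d, L» and on the O(1) of (3.35); any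
admissible O(1)).  (c) `K₆ = 1`: [4]'s α₀ is read as [B8]'s α₀ (the binder's `K₆` slot allows a rescaling; none needed).  (d) NOTHING of [4] (Thms 3.1 ∕ 3.3 ∕
3.11) is touched; (3.36) is not produced (no binder reads `Reg336`).  (e) Proposition 6 itself is CONSUMED by name (§2 hypothesis ∕ §3 `prop6Printed_zdCubP_γ_holds`,
dag-n05-e F1 p596570 — itself the composition of the γ flat line, dag-n05-c's T4 transplant and dag-k0-s2-w1's print-class laws); this file adds the p. 98
inscription and bookkeeping only.  Count-neutral; N05 ∕ N06 NOT discharged; one finite lattice programme at fixed spacing, Bałaban AS PRINTED; nothing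
continuum ∕ ℝ⁴ ∕ OS ∕ mass-gap ∕ Clay.  No `sorry`, no `axiom`, no definition, no `instance`, no `notation`.  Unit `pub-ymgap-dag-n05-e` (g14), 2026-08-28.
v1.1 (g15, same day): DOCSTRING-ONLY edition — the p. 98 `k = 0` sentence quoted in full (print SUBSUMES `k = 0` in the general case; §2's index-0 branch via
`B8Prop6Reg335Cube.reg335Cube_index_zero` is this seat's elementary argument, as in the companion's v1.1), the declaration census made precise (7 theorems + one
auto-generated `eq_1`), and HONEST SCOPE (a) pointed to the law-member companion (referee pub-ymgap-dag-ref-E READ-23 NIT-1 ∕ NIT-2); declarations unchanged.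
v1.2 (g15): DOCSTRING-ONLY — the eighth ledger declaration named exactly (`bigSideZd.eq_1` of the frame's `def`, realised by §1 ∕ §2's `simp`∕`rw`; v1.1 had
mis-attributed it to a proof-local `let`); declarations unchanged.
-/

noncomputable section

open NormedSpace

namespace Literature.MathematicalPhysics.QuantumFieldTheory.Balaban1983to89.B8Prop6Reg335ZdAllTorus

open B7Prop1Explicit B7Prop2Explicit B7Prop1Local
open B8Ineq132 (InAk CondAt plaqF PlaqTouches)
open B8LeafModelZd (ZdIdx)
open B8Eq131Cubes (box bLo bHi)
open B8Eq133Hypotheses (Reg335Zd shiftT byDir)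
open B9Eq335RegularityClasses (Reg335Cube Reg335)
open LatticeNorms (scaleLen)
open B8Thm2TorusMember (TorusMember torusIdx)
open B9SupplySockB9P3ZdAt (Prop6At)
open B9SupplySockB9P3ZdFrame (MemberZd memZd bgZd ιCfgZd cubeClass396Zd IsCube396Zd boxZd bigSideZd OmTrunc reg335_bgZd_iff)
open B8Prop6Reg335Cube (reg335Cube_of_gaugedBoundB8 reg335Cube_index_zero)
open B8Prop6PrintedZdCubPGamma (prop6Printed_zdCubP_γ_holds)
open Node00 (CubeB8 GaugedBoundB8 zdCubP prop6Printed_zdCubP_iff)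

variable {d : ℕ}

/-! ## §1 The inscription of [4]'s p. 396 class cubes into print's p. 98 cubes at `Ω ≡ ℤᵈ` -/

/-- A site of the box `{z | c_μ ≤ z_μ < c_μ + s}` is within `ℓ¹`-distance `d·s` of its corner (bookkeeping). [cite: Balaban1985BackgroundPropagators, p.396 («its size in the lattice T_η is O(1)MLʲη»)] -/
theorem l1_le_of_mem_boxZd {c z : B7Prop1Explicit.Site d} {s : ℕ} (hz : z ∈ boxZd c s) : l1 (z - c) ≤ d * s := by
  classical
  unfold l1
  have h : ∀ κ ∈ (Finset.univ : Finset (Fin d)), ((z - c) κ).natAbs ≤ s := fun κ _ => by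
    obtain ⟨h1, h2⟩ := hz κ
    have h3 : 0 ≤ (z - c) κ := by simp only [Pi.sub_apply]; omega
    have h4 : (z - c) κ < s := by simp only [Pi.sub_apply]; omega
    omega
  calc ∑ κ, ((z - c) κ).natAbs ≤ ∑ _κ : Fin d, s := Finset.sum_le_sum h
    _ = d * s := by simp

/-- ★ **THE INSCRIPTION** (print p. 98: «we take a size of □ equal to MLʲη, where M is a multiple of R₁M₁ … we can assume also that j = k»; [4] p. 396: «□ is a
union of several big blocks of the lattice T_{Lʲη} … its size … is O(1)MLʲη. Here O(1) will mean a number ≤ 10»): at `Ω ≡ ℤᵈ`, a cube `□` of the p. 396 class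
of index `j`, `1 ≤ j ≤ m` (`IsCube396Zd M L j □`) lies in `box L c.a c.M c.k` of a print cube `c` of NODE 00's carrier with `c.IsPrint ρ₀`, `c.k = j`, and side
`c.M ≤ ρ₀·L·(10⌈M⌉₊ + 11d + 1)` — corner = `□`'s corner rounded down to the `ρ₀`-grid of the `Lʲ`-lattice, collar `ρ = ρ₀L`, side `ρ₀L(n⌈M⌉₊ + 11d + 1)`.
[cite: Balaban1985RegularSpaces, p.98 («a size of □ equal to MLʲη, where M is a multiple of R₁M₁», «L⁻¹RM > 2dR₁M₁»), (1.130) p.99; Balaban1985BackgroundPropagators, p.396 (the cube class)] -/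
theorem exists_printCube_over_classCube (hd : 1 ≤ d) {L : ℕ} (hL : 1 ≤ L) {ρ₀ : ℕ} (hρ₀ : 1 ≤ ρ₀) {M : ℝ} {j m : ℕ} (hj1 : 1 ≤ j) (hjm : j ≤ m)
    {Q : Set (B7Prop1Explicit.Site d)} (hQ : IsCube396Zd M L j Q) :
    ∃ c : CubeB8 d L m (fun _ : ℕ => (Set.univ : Set (B7Prop1Explicit.Site d))),
      c.IsPrint ρ₀ ∧ c.k = j ∧ Q ⊆ box L c.a c.M c.k ∧ c.M ≤ ρ₀ * L * (10 * ⌈M⌉₊ + 11 * d + 1) := by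
  obtain ⟨c₀, n, hn1, hn10, hdvd, rfl⟩ := hQ
  -- letters: the side `s = n⌈M⌉₊` in `Lʲ`-blocks, the corner `a₀ = c₀ / Lʲ` on the `Lʲ`-lattice, its `ρ₀`-rounding `a`
  set s : ℕ := n * ⌈M⌉₊ with hs
  have hLj : (0 : ℤ) < (L : ℤ) ^ j := by positivity
  have hρ0 : (0 : ℤ) < (ρ₀ : ℤ) := by exact_mod_cast hρ₀
  have hside : (bigSideZd M L j : ℤ) = (⌈M⌉₊ : ℤ) * (L : ℤ) ^ j := by simp [bigSideZd]
  have hdvdL : ∀ μ, ((L : ℤ) ^ j) ∣ c₀ μ := fun μ => (Dvd.intro_left _ (by rw [hside])).trans (hdvd μ)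
  set a₀ : B7Prop1Explicit.Site d := fun μ => c₀ μ / (L : ℤ) ^ j with ha₀
  have hc₀ : ∀ μ, c₀ μ = (L : ℤ) ^ j * a₀ μ := fun μ => by
    rw [ha₀]; exact (Int.mul_ediv_cancel' (hdvdL μ)).symm
  set a : B7Prop1Explicit.Site d := fun μ => a₀ μ / (ρ₀ : ℤ) * (ρ₀ : ℤ) with ha
  have ha_def : ∀ μ, a μ = a₀ μ / (ρ₀ : ℤ) * (ρ₀ : ℤ) := fun μ => rfl
  have ha_le : ∀ μ, a μ ≤ a₀ μ := fun μ => by rw [ha_def]; exact Int.ediv_mul_le _ hρ0.ne'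
  have ha_lt : ∀ μ, a₀ μ < a μ + ρ₀ := fun μ => by
    have h1 := Int.emod_lt_of_pos (a₀ μ) hρ0
    have h2 : a₀ μ % ρ₀ = a₀ μ - a μ := by rw [Int.emod_def, ha_def]; ring
    linarith
  -- the cube: index `j`, corner `a`, side `Mc = ρ₀L(s + 11d + 1)`, collar `ρ₀L`
  set Mc : ℕ := ρ₀ * L * (s + 11 * d + 1) with hMc
  have hρ0' : 0 < ρ₀ := hρ₀
  have hρL : 0 < ρ₀ * L := Nat.mul_pos hρ0' hL
  have hMc1 : ρ₀ * L ≤ Mc := Nat.le_mul_of_pos_right _ (by omega)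
  have hMc2 : s + 11 * d + 1 ≤ Mc := Nat.le_mul_of_pos_left _ hρL
  have hLρ : L ≤ ρ₀ * L := Nat.le_mul_of_pos_left L hρ0'
  have hLdM : L ≤ d * Mc := (hLρ.trans hMc1).trans (Nat.le_mul_of_pos_left _ hd)
  let c : CubeB8 d L m (fun _ : ℕ => (Set.univ : Set (B7Prop1Explicit.Site d))) :=
    ⟨j, a, Mc, ρ₀ * L, hj1, hjm, hLρ, hMc1, by omega, hLdM, fun _ _ => Set.mem_univ _, fun _ _ => Set.mem_univ _⟩
  have hcM : c.M = Mc := rfl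
  have hca : c.a = a := rfl
  have hck : c.k = j := rfl
  have hcρ : c.ρ = ρ₀ * L := rfl
  refine ⟨c, ⟨?_, ?_, fun μ => ?_⟩, hck, ?_, ?_⟩
  · rw [hcρ]; exact Dvd.intro L rfl
  · rw [hcM, hMc]; exact Dvd.intro (L * (s + 11 * d + 1)) (by ring)
  · rw [hca, ha_def]; exact Dvd.intro (a₀ μ / ρ₀) (by ring)
  · -- `□ ⊆ box L a Mc j`
    rw [hca, hcM, hck]
    intro x hx μ
    obtain ⟨h1, h2⟩ := hx μ
    have h3 : (ρ₀ : ℤ) + s ≤ (Mc : ℤ) := by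
      have h4 : ρ₀ + s ≤ Mc := by
        calc ρ₀ + s ≤ ρ₀ * (s + 1) := by nlinarith
          _ ≤ (ρ₀ * L) * (s + 1) := Nat.mul_le_mul_right _ (Nat.le_mul_of_pos_right _ (by omega))
          _ ≤ (ρ₀ * L) * (s + 11 * d + 1) := Nat.mul_le_mul_left _ (by omega)
      exact_mod_cast h4
    have hbs : ((n * bigSideZd M L j : ℕ) : ℤ) = (s : ℤ) * (L : ℤ) ^ j := by
      rw [hs]; push_cast [bigSideZd]; ring
    rw [hbs] at h2
    show bLo L a j 0 μ ≤ x μ ∧ x μ ≤ bHi L a Mc j 0 μ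
    simp only [bLo, bHi, Nat.cast_zero, sub_zero, add_zero]
    constructor
    · calc (L : ℤ) ^ j * a μ ≤ (L : ℤ) ^ j * a₀ μ := mul_le_mul_of_nonneg_left (ha_le μ) hLj.le
        _ = c₀ μ := (hc₀ μ).symm
        _ ≤ x μ := h1
    · have h4 : x μ < (L : ℤ) ^ j * (a μ + ρ₀ + s) := by
        calc x μ < c₀ μ + s * (L : ℤ) ^ j := h2
          _ = (L : ℤ) ^ j * (a₀ μ + s) := by rw [hc₀ μ]; ring
          _ ≤ (L : ℤ) ^ j * (a μ + ρ₀ + s) := mul_le_mul_of_nonneg_left (by linarith [ha_lt μ]) hLj.le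
      have h5 : (L : ℤ) ^ j * (a μ + ρ₀ + s) ≤ (L : ℤ) ^ j * (a μ + Mc) := mul_le_mul_of_nonneg_left (by linarith) hLj.le
      linarith
  · -- the size
    have h6 : s ≤ 10 * ⌈M⌉₊ := by rw [hs]; exact Nat.mul_le_mul_right _ hn10
    rw [hcM]
    exact Nat.mul_le_mul_left _ (by omega)

/-! ## §2 (3.35) for `U₀ ∈ 𝔄_m` by Proposition 6, at the frame of record, at the all-torus members -/

section AtFrame

variable {𝔸 : Type} [CStarAlgebra 𝔸] [Nontrivial 𝔸]

omit [Nontrivial 𝔸] in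
/-- **`Prop6At` at `bgZd` is monotone in the constant `c35`** ([4]'s «O(1)» in (3.35) is any admissible number; the bounds are strict upper bounds).
[cite: Balaban1985BackgroundPropagators, (3.35) p.396; Balaban1985RegularSpaces, Prop. 6 p.99] -/
theorem prop6At_bgZd_mono {L : ℕ} (hL : 1 ≤ L) {c35 c35' c₆ K₆ M : ℝ} (hc : c35 ≤ c35') (hM : 0 ≤ M) (hK : 0 ≤ K₆) {i : ZdIdx d L} {m : ℕ}
    (h : Prop6At (bgZd 𝔸 L) L memZd (ιCfgZd 𝔸 L) c35 c₆ K₆ M i m) : Prop6At (bgZd 𝔸 L) L memZd (ιCfgZd 𝔸 L) c35' c₆ K₆ M i m := by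
  intro α₀ U₀ hU₀ hα₀ hMα hIn
  have hL' : (0 : ℝ) < L := by exact_mod_cast hL
  have h1 := h α₀ U₀ hU₀ hα₀ hMα hIn
  rw [reg335_bgZd_iff] at h1 ⊢
  intro q hq
  obtain ⟨u, A, hu, hrep, hA, hD⟩ := h1 q hq
  have hcc : c35 * (memZd M i m).M * (K₆ * α₀) ≤ c35' * (memZd M i m).M * (K₆ * α₀) := by
    have : (memZd M i m).M = M := rfl
    rw [this]
    exact mul_le_mul_of_nonneg_right (mul_le_mul_of_nonneg_right hc hM) (mul_nonneg hK hα₀.le)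
  refine ⟨u, A, hu, hrep, fun κ z hz => (hA κ z hz).trans_le ?_, fun κ ν z hz => (hD κ ν z hz).trans_le ?_⟩
  · exact mul_le_mul_of_nonneg_right hcc (inv_nonneg.mpr (LatticeNorms.scaleLen_pos hL' (memZd M i m).i.hη q.2).le)
  · exact mul_le_mul_of_nonneg_right hcc (inv_nonneg.mpr (pow_nonneg (LatticeNorms.scaleLen_pos hL' (memZd M i m).i.hη q.2).le 2))

/-- ★★ **(3.35) FOR `U₀ ∈ 𝔄_m({ℤᵈ}, α₀)` BY PROPOSITION 6, AT THE FRAME OF RECORD** (print p. 99: «hence for α₀ sufficiently small we have proved the regularity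
condition (3.35). This implies that we can drop out this condition from the assumption (1.33)»): for `d ≥ 2`, `L ≥ 2`, `ρ₀ ≥ 1`, `B₁ ≥ 0`, `c₁ > 0` with
`B8.Prop6Printed d L B₁ c₁ (zdCubP 𝔸 L ρ₀ ∘ f)` for every index map `f`, at EVERY all-torus member `i` (`∀ j, i.Ω j = univ`), every block parameter `M ≥ 1` and
every truncation `m`, dag-n06-b's junction binder holds at dag-n06-e's frame with `c35 := 7dL³B₁ρ₀(11d + 21) + 84d + 1`, `c₆ := min (1∕(42d)) (c₁∕(7dL³ρ₀(11d + 21)))`,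
`K₆ := 1`: index-0 class cubes by the axial gauge (`reg335Cube_index_zero`), index-`j ≥ 1` class cubes inscribed (§1) into a print cube of the auxiliary all-torus
datum `torusIdx ⟨i.η, m⟩` where Proposition 6 gives (1.135)–(1.136) and `reg335Cube_of_gaugedBoundB8` reads it as (3.35).
[cite: Balaban1985RegularSpaces, Prop. 6 (1.135)–(1.136) p.99, p.98, (1.33) p.82; Balaban1985BackgroundPropagators, (3.35) p.396] -/
theorem prop6At_bgZd_allTorus_of_prop6Printed (hd2 : 2 ≤ d) {L : ℕ} (hL : 2 ≤ L) {ρ₀ : ℕ} (hρ₀ : 1 ≤ ρ₀) {B₁ c₁ : ℝ} (hB₁ : 0 ≤ B₁) (hc₁ : 0 < c₁)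
    (hP6 : ∀ {ι : Type} (f : ι → ZdIdx d L), B8.Prop6Printed d (L : ℝ) B₁ c₁ (fun j => zdCubP 𝔸 L ρ₀ (f j)))
    {M : ℝ} (hM : 1 ≤ M) (i : ZdIdx d L) (hΩ : ∀ j, i.Ω j = Set.univ) (m : ℕ) :
    Prop6At (bgZd 𝔸 L) L memZd (ιCfgZd 𝔸 L)
      (7 * d * (L : ℝ) ^ 3 * B₁ * ρ₀ * (11 * d + 21) + 84 * d + 1) (min (1 / (42 * d)) (c₁ / (7 * d * (L : ℝ) ^ 3 * ρ₀ * (11 * d + 21)))) 1 M i m := by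
  intro α₀ U₀ hU₀ hα₀ hMα hIn
  rw [reg335_bgZd_iff]
  -- letters and positivity
  have hd1 : 1 ≤ d := le_trans one_le_two hd2
  have hL1 : 1 ≤ L := le_trans one_le_two hL
  have hdR : (1 : ℝ) ≤ d := by exact_mod_cast hd1
  have hLR : (2 : ℝ) ≤ L := by exact_mod_cast hL
  have hρR : (1 : ℝ) ≤ ρ₀ := by exact_mod_cast hρ₀
  have hd0 : (0 : ℝ) < d := by linarith
  have hL0 : (0 : ℝ) < L := by linarith
  have hρ0 : (0 : ℝ) < ρ₀ := by linarith
  have hη : 0 < i.η := i.hη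
  have hM0 : 0 ≤ M := le_trans zero_le_one hM
  have hMα' : M * α₀ ≤ 1 / (42 * d) := hMα.trans (min_le_left _ _)
  have hMα'' : M * α₀ ≤ c₁ / (7 * d * (L : ℝ) ^ 3 * ρ₀ * (11 * d + 21)) := hMα.trans (min_le_right _ _)
  have hceil : (⌈M⌉₊ : ℝ) ≤ 2 * M := by
    have := Nat.ceil_lt_add_one hM0
    linarith
  have hU1 : ∀ x κ, U₀ x κ ∈ U1 𝔸 := fun x κ => unitaryUnits_le_U1 (hU₀ x κ)
  -- the constant is `C = c35·M·(1·α₀)`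
  set C : ℝ := (7 * d * (L : ℝ) ^ 3 * B₁ * ρ₀ * (11 * d + 21) + 84 * d + 1) * (memZd M i m).M * (1 * α₀) with hC
  have hCM : (memZd M i m).M = M := rfl
  intro q hq
  obtain ⟨hjm, hcube, -, -, -⟩ := hq
  change q.2 ≤ m at hjm
  change IsCube396Zd M L q.2 q.1 at hcube
  rcases Nat.eq_zero_or_pos q.2 with hj0 | hjpos
  · -- INDEX 0: the axial gauge
    obtain ⟨c₀, n, hn1, hn10, -, hQ⟩ := hcube
    have hcond := (hIn 0 (Nat.zero_le m)).1
    have h44 : ∀ (x : B7Prop1Explicit.Site d) (κ μ : Fin d), κ ≠ μ → ‖((hol U₀ x (plaqWord κ μ) : 𝔸ˣ) : 𝔸) - 1‖ ≤ α₀ := fun x κ μ hκμ => by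
      have h := hcond x κ μ hκμ (Or.inl (by rw [hΩ 0]; exact Set.mem_univ x))
      simp only [pow_zero, inv_one, one_pow, mul_one] at h
      exact h.le
    have hrad : ∀ z ∈ q.1, (l1 (z - c₀) : ℝ) ≤ 20 * d * M := fun z hz => by
      rw [hQ] at hz
      have h1 := l1_le_of_mem_boxZd hz
      have h2 : (l1 (z - c₀) : ℝ) ≤ d * (n * (⌈M⌉₊ * 1)) := by
        have : bigSideZd M L q.2 = ⌈M⌉₊ * 1 := by rw [bigSideZd, hj0, pow_zero]
        rw [this] at h1; exact_mod_cast h1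
      have hn10R : (n : ℝ) ≤ 10 := by exact_mod_cast hn10
      have h3 : (d : ℝ) * (n * (⌈M⌉₊ * 1)) ≤ d * (10 * (2 * M)) := by
        apply mul_le_mul_of_nonneg_left _ (by positivity)
        rw [mul_one]
        exact mul_le_mul hn10R hceil (by positivity) (by norm_num)
      linarith
    have hdM : (1 : ℝ) ≤ d * M := one_le_mul_of_one_le_of_one_le hdR hM
    have hdMα : α₀ ≤ d * M * α₀ := by nlinarith
    have hsmall : (20 * d * M + 1) * α₀ ≤ 1 / 2 := by
      have h1 : (20 * d * M + 1) * α₀ ≤ 21 * d * (M * α₀) := by nlinarith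
      have h2 : 21 * d * (M * α₀) ≤ 21 * d * (1 / (42 * d)) := mul_le_mul_of_nonneg_left hMα' (by positivity)
      have h3 : 21 * (d : ℝ) * (1 / (42 * d)) = 1 / 2 := by field_simp; ring
      linarith
    have hCgt : 4 * (20 * d * M + 1) * α₀ < C := by
      rw [hC, hCM]
      have h1 : 4 * (20 * d * M + 1) * α₀ ≤ 84 * d * M * α₀ := by nlinarith [hdMα]
      have h2 : 84 * d * M * α₀ < (7 * d * (L : ℝ) ^ 3 * B₁ * ρ₀ * (11 * d + 21) + 84 * d + 1) * M * (1 * α₀) := by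
        have h3 : 0 ≤ 7 * d * (L : ℝ) ^ 3 * B₁ * ρ₀ * (11 * d + 21) := by positivity
        nlinarith [mul_pos (lt_of_lt_of_le one_pos hM) hα₀]
      linarith
    rw [hj0]
    exact reg335Cube_index_zero hU1 hη L hα₀.le (by positivity) hsmall h44 hrad hCgt
  · -- INDEX `j ≥ 1`: Proposition 6 at an inscribed print cube of the auxiliary all-torus datum
    have hm1 : 1 ≤ m := le_trans (Nat.succ_le_of_lt hjpos) hjm
    obtain ⟨c, hcP, hck, hQc, hcM⟩ := exists_printCube_over_classCube hd1 hL1 hρ₀ (j := q.2) (m := m) hjpos hjm hcube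
    -- `U₀ ∈ 𝔄_m` IS the `InA` of the auxiliary datum (same `η`, `Ω ≡ ℤᵈ`)
    have hΩ' : i.Ω = fun _ => Set.univ := funext hΩ
    have hIn' : InAk L m i.η α₀ (fun _ : ℕ => (Set.univ : Set (B7Prop1Explicit.Site d))) U₀ := by rw [← hΩ']; exact hIn
    -- Proposition 6 at the cube (threshold from `Mα₀ ≤ c₆`)
    have hP := (prop6Printed_zdCubP_iff (𝔸 := 𝔸) (fun _ : Unit => torusIdx (d := d) hL1 ⟨i.η, i.hη, m, hm1⟩) ρ₀ B₁ c₁).1 (hP6 _) () α₀ hα₀ ⟨U₀, hU₀⟩ hIn' c hcP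
    have hcMR : (c.M : ℝ) ≤ ρ₀ * L * (11 * d + 21) * M := by
      have h1 : (c.M : ℝ) ≤ ρ₀ * L * (10 * ⌈M⌉₊ + 11 * d + 1) := by exact_mod_cast hcM
      have h2 : (10 * ⌈M⌉₊ + 11 * d + 1 : ℝ) ≤ (11 * d + 21) * M := by
        nlinarith [mul_nonneg (sub_nonneg.2 hdR) (sub_nonneg.2 hM), hceil]
      have h3 : (ρ₀ : ℝ) * L * (10 * ⌈M⌉₊ + 11 * d + 1) ≤ ρ₀ * L * ((11 * d + 21) * M) := mul_le_mul_of_nonneg_left h2 (by positivity)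
      linarith
    have hthr : 7 * d * (L : ℝ) ^ 2 * c.M * α₀ ≤ c₁ := by
      have h1 : 7 * d * (L : ℝ) ^ 2 * c.M * α₀ ≤ 7 * d * (L : ℝ) ^ 2 * (ρ₀ * L * (11 * d + 21) * M) * α₀ := by
        apply mul_le_mul_of_nonneg_right _ hα₀.le
        exact mul_le_mul_of_nonneg_left hcMR (by positivity)
      have h2 : 7 * d * (L : ℝ) ^ 2 * (ρ₀ * L * (11 * d + 21) * M) * α₀ = 7 * d * (L : ℝ) ^ 3 * ρ₀ * (11 * d + 21) * (M * α₀) := by ring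
      have hpos : 0 < 7 * d * (L : ℝ) ^ 3 * ρ₀ * (11 * d + 21) := by positivity
      have h3 : 7 * d * (L : ℝ) ^ 3 * ρ₀ * (11 * d + 21) * (M * α₀) ≤ c₁ :=
        calc 7 * d * (L : ℝ) ^ 3 * ρ₀ * (11 * d + 21) * (M * α₀)
            ≤ 7 * d * (L : ℝ) ^ 3 * ρ₀ * (11 * d + 21) * (c₁ / (7 * d * (L : ℝ) ^ 3 * ρ₀ * (11 * d + 21))) :=
              mul_le_mul_of_nonneg_left hMα'' hpos.le
          _ = c₁ := by field_simp
      linarith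
    have hG : GaugedBoundB8 L i.η U₀ c (7 * d * (L : ℝ) ^ 2 * B₁ * c.M * α₀) := hP hthr
    -- the bridge, with `r = 7dL²B₁·c.M·α₀ < C`
    have hrC : 7 * d * (L : ℝ) ^ 2 * B₁ * c.M * α₀ < C := by
      rw [hC, hCM]
      have h1 : 7 * d * (L : ℝ) ^ 2 * B₁ * c.M * α₀ ≤ 7 * d * (L : ℝ) ^ 3 * B₁ * ρ₀ * (11 * d + 21) * M * α₀ := by
        have : 7 * d * (L : ℝ) ^ 2 * B₁ * c.M * α₀ ≤ 7 * d * (L : ℝ) ^ 2 * B₁ * (ρ₀ * L * (11 * d + 21) * M) * α₀ := by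
          apply mul_le_mul_of_nonneg_right _ hα₀.le
          exact mul_le_mul_of_nonneg_left hcMR (by positivity)
        linarith [this]
      have h2 : 0 < (84 * d + 1) * M * α₀ := by
        have := mul_pos (lt_of_lt_of_le one_pos hM) hα₀
        positivity
      nlinarith
    have hres := reg335Cube_of_gaugedBoundB8 hd2 hL hη c hrC hG hQc
    rw [hck] at hres
    exact hres

/-- **`∃`-PACKAGING** of `prop6At_bgZd_allTorus_of_prop6Printed`: positive constants `c35, c₆` and `K₆ = 1` serving every all-torus member, every `M ≥ 1`
and every truncation. [cite: Balaban1985RegularSpaces, Prop. 6 p.99, (1.33) p.82; Balaban1985BackgroundPropagators, (3.35) p.396] -/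
theorem exists_prop6At_bgZd_allTorus_of_prop6Printed (hd2 : 2 ≤ d) {L : ℕ} (hL : 2 ≤ L) {ρ₀ : ℕ} (hρ₀ : 1 ≤ ρ₀) {B₁ c₁ : ℝ} (hB₁ : 0 ≤ B₁) (hc₁ : 0 < c₁)
    (hP6 : ∀ {ι : Type} (f : ι → ZdIdx d L), B8.Prop6Printed d (L : ℝ) B₁ c₁ (fun j => zdCubP 𝔸 L ρ₀ (f j))) :
    ∃ c35 c₆ K₆ : ℝ, 0 < c35 ∧ 0 < c₆ ∧ 0 < K₆ ∧
      ∀ (M : ℝ) (i : ZdIdx d L) (m : ℕ), (∀ j, i.Ω j = Set.univ) → 1 ≤ M →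
        Prop6At (bgZd 𝔸 L) L memZd (ιCfgZd 𝔸 L) c35 c₆ K₆ M i m := by
  have hdR : (1 : ℝ) ≤ d := by exact_mod_cast (le_trans one_le_two hd2)
  have hLR : (2 : ℝ) ≤ L := by exact_mod_cast hL
  have hρR : (1 : ℝ) ≤ ρ₀ := by exact_mod_cast hρ₀
  have hd0 : (0 : ℝ) < d := by linarith
  have hL0 : (0 : ℝ) < L := by linarith
  have hρ0 : (0 : ℝ) < ρ₀ := by linarith
  refine ⟨7 * d * (L : ℝ) ^ 3 * B₁ * ρ₀ * (11 * d + 21) + 84 * d + 1, min (1 / (42 * d)) (c₁ / (7 * d * (L : ℝ) ^ 3 * ρ₀ * (11 * d + 21))), 1,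
    by positivity, lt_min (by positivity) (by positivity), one_pos, fun M i m hΩ hM => ?_⟩
  exact prop6At_bgZd_allTorus_of_prop6Printed hd2 hL hρ₀ hB₁ hc₁ hP6 hM i hΩ m

end AtFrame

/-! ## §3 The unconditional form: `d ≥ 2`, `L ≥ 5` odd -/

section Holds

variable {𝔸 : Type} [CStarAlgebra 𝔸] [Nontrivial 𝔸]

/-- ★★★ **[B8] PROPOSITION 6's PRINTED APPLICATION, UNCONDITIONAL** (`d ≥ 2`, `L ≥ 5` odd, any nontrivial C⋆-algebra `𝔸`): there are `c35, c₆, K₆ > 0` such that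
for every block parameter `M ≥ 1`, every all-torus member `i : ZdIdx d L` (`∀ j, i.Ω j = univ`) and every truncation `m`, dag-n06-b's junction binder
`Prop6At (bgZd 𝔸 L) L memZd (ιCfgZd 𝔸 L) c35 c₆ K₆ M i m` — «U₀ ∈ 𝔄_m({Ω_j}, α₀), Mα₀ ≤ c₆ ⇒ U₀ satisfies the regularity condition (3.35) in [4] on the p. 396
cube class with O(1)Mα₀ = c35·M·K₆α₀» — HOLDS: §2 ∘ `B8Prop6PrintedZdCubPGamma.prop6Printed_zdCubP_γ_holds` (Proposition 6 AS PRINTED on print's cube class,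
unconditional; `B₁ = 5dLB₀`).  The second clause of (1.33) is thereby dropped, as print says, at the frame of record for these members.
[cite: Balaban1985RegularSpaces, Prop. 6 (1.135)–(1.138) p.99, (1.33) p.82, p.98; Balaban1985BackgroundPropagators, (3.35) p.396] -/
theorem prop6At_bgZd_allTorus_holds (hd2 : 2 ≤ d) {L : ℕ} (hL5 : 5 ≤ L) (hodd : Odd L) :
    ∃ c35 c₆ K₆ : ℝ, 0 < c35 ∧ 0 < c₆ ∧ 0 < K₆ ∧
      ∀ (M : ℝ) (i : ZdIdx d L) (m : ℕ), (∀ j, i.Ω j = Set.univ) → 1 ≤ M →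
        Prop6At (bgZd 𝔸 L) L memZd (ιCfgZd 𝔸 L) c35 c₆ K₆ M i m := by
  obtain ⟨ρ₀, B₀, c₁, hρ₀, hB₀, hc₁, H⟩ := prop6Printed_zdCubP_γ_holds (𝔸 := 𝔸) hd2 hL5 hodd
  have hB₁ : 0 ≤ 5 * (d : ℝ) * L * B₀ := by
    have : (0 : ℝ) ≤ B₀ := le_trans zero_le_one hB₀
    positivity
  exact exists_prop6At_bgZd_allTorus_of_prop6Printed hd2 (le_trans (by norm_num) hL5) hρ₀ hB₁ hc₁ (fun f => H f)

/-- ★★★ **THE CONSUMERS' BINDER SHAPE** (`BalabanUVNodesN16LeafLettersAllTorusOfThm33.sockB9P3_allLevels_allTorusPinned_of_thm33`'s `hP6`, the N27 ∕ K3-spine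
producers): for `d ≥ 2`, `L ≥ 5` odd, any further pin `P` on the datum (e.g. the `Λs ∕ Λb ∕ η = L^{−k}` clauses), there are `c35 c₆ K₆ M₃ > 0` (`M₃ = 1`) with
`∀ (M : ℝ) (i : {i // (∀ j, i.Ω j = univ) ∧ P i}) (m : ℕ), M₃ ≤ M → Prop6At (bgZd 𝔸 L) L memZd (ιCfgZd 𝔸 L) c35 c₆ K₆ M i.1 m` — the binder AS TYPED at
`bg := bgZd 𝔸 L`, `mem := memZd`, `ιCfg := ιCfgZd 𝔸 L`. [cite: Balaban1985RegularSpaces, Prop. 6 p.99, (1.33) p.82; Balaban1985BackgroundPropagators, (3.35) p.396, Thm 3.3 p.399] -/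
theorem prop6At_binder_allTorusPinned_holds (hd2 : 2 ≤ d) {L : ℕ} (hL5 : 5 ≤ L) (hodd : Odd L) (P : ZdIdx d L → Prop) :
    ∃ c35 c₆ K₆ M₃ : ℝ, 0 < c35 ∧ 0 < c₆ ∧ 0 < K₆ ∧ 0 < M₃ ∧
      ∀ (M : ℝ) (i : {i : ZdIdx d L // (∀ j, i.Ω j = Set.univ) ∧ P i}) (m : ℕ), M₃ ≤ M →
        Prop6At (bgZd 𝔸 L) L memZd (ιCfgZd 𝔸 L) c35 c₆ K₆ M i.1 m := by
  obtain ⟨c35, c₆, K₆, h35, h₆, hK, H⟩ := prop6At_bgZd_allTorus_holds (𝔸 := 𝔸) hd2 hL5 hodd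
  exact ⟨c35, c₆, K₆, 1, h35, h₆, hK, one_pos, fun M i m hM => H M i.1 m i.2.1 hM⟩

end Holds

end Literature.MathematicalPhysics.QuantumFieldTheory.Balaban1983to89.B8Prop6Reg335ZdAllTorus

end
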